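import Summits.BirchSwinnertonDyer.BirchSwinnertonDyer.Theorems.SignedLowerHalvesSmallImageLowerHalfBothSignsRttD2SeqSemilocTower
import Literature.NumberTheory.GaloisRepresentations.ContinuousCupProductCompat
import Literature.NumberTheory.GaloisRepresentations.ContinuousShapiroLiftPairing
import Literature.NumberTheory.GaloisRepresentations.ContinuousShapiroLiftCores
import HarnessLib

/-!
# Route `SignedLowerHalves`, crux L `SmallImageLowerHalfBothSigns` (stmt-BirchSwinnertonDyer-23599), line `rtt_w3` v26 — stub S3β (`stub_junctionPT_ns`, row J4′,
# Poitou–Tate half), brick N2a: THE TRANSPOSE LAWS OF THE SEMILOCAL LEVEL PAIRING `semilocPairNK` (cores ⊣ res, conj ⊣ conj⁻¹) —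
# the X-side transition of the semilocal layer group `Lloc_w(n,k) = H¹(K_w, Maps(Γ_K ⧸ U_n, X_k))` is adjoint, under THE canonical local Tate pairing at `w`, to the
# A-side operation on the global layer classes `H¹(U_n, M[p^k])`

WIDTH seat `bsd-line-slh-p3-w3` g25 under LEAD `cruxlead-stmt-BirchSwinnertonDyer-23599` g13 (cell `bsd-ssimc`); helper `--supports stmt-BirchSwinnertonDyer-23599`
(design memo `Lines/rtt_w3-DESIGN-S3beta-w3-g25.md`, rev 3 §5 N2a). ONE DEFINITION WITH BODY (`tateDualTranspose`, the transpose `F ↦ F ∘ α` on Tate duals) + THEOREMS; no named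
fact, no instance, no `sorry`. HONEST FRAMING: bookkeeping for the semilocal tower pairing `Hloc_w × Sel(K_∞) → ℚ/ℤ` (brick N2 of S3β); nothing about S3β, E2, crux L or BSD is
proved; all remain OPEN and are proved for NO curve.

WHAT.
* §1 `tateDualTranspose ρ₁ ρ₂ N α : (ρ₁^D).toTopRep ⟶ (ρ₂^D).toTopRep` for `α : ρ₂.toTopRep ⟶ ρ₁.toTopRep` (`F ↦ F ∘ α`), `tateDualTranspose_hom_apply`.
* §2 THE GENERIC TRANSPOSE LAW ★★ `semilocPairNK_semilocH_eq`: for a `Γ_K`-morphism `α : Maps(Γ_K ⧸ U_{n′}, X_k) → Maps(Γ_K ⧸ U_n, X_k)` of the coinduced X-modules and a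
  `Γ_K`-morphism `β : Maps(Γ_K ⧸ U_n, M[p^k]) → Maps(Γ_K ⧸ U_{n′}, M[p^k])` of the coinduced A-modules that are ADJOINT for the summed level pairings
  (`Σ_y B((α φ) y, ψ y) = Σ_{y′} B(φ y′, (β ψ) y′)`), and layer classes `c ∈ H¹(U_n, M[p^k])`, `c′ ∈ H¹(U_{n′}, M[p^k])` with `Sh_{U_{n′}} c′ = H¹(β)(Sh_{U_n} c)`:
  `⟨H¹(α|_w) t, semilocDual c⟩_{w,n} = ⟨t, semilocDual c′⟩_{w,n′}`. Proof: adjoint naturality of the cup product at `Γ_{K_w}` for (`α|_w`, `αᴰ|_w`) (`ContPairing.cupProduct_adjoint`, the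
  evaluation pairings), naturality of `res_w`, and the global module identity `αᴰ ∘ Ψ_n = Ψ_{n′} ∘ β` (`Ψ = coindTateDualMor`, `tateDualPairing_toLin_coindTateDualMor`).
* §3 THE LAWS: ★★ `semilocPairNK_semilocCores` (L1, cores ⊣ res: `α = coindFinSum`, `β = coindFinRes`, `toLin_coindFinSum_left`, `cohomologyMap_coindFinRes_shapiroCocycle`) and
  ★★ `semilocPairNK_semilocConj` (L3, `R_γ ⊣ conj_{γ⁻¹}`: `α = rTransHom γ`, `β = rTransHom γ⁻¹`, `toLin_rTransHom`, `shapiroLift_conjMap`).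
References: [NeukirchSchmidtWingberg2008] I §4 (1.4.2), I §5 Prop. (1.5.3)(iv), I §6 (1.6.4)–(1.6.5), (7.2.6), (8.6.2); [MilneADT2006] I Cor. 2.3; [SerreLocalFields1979] VII §5–§6;
[Rubin2000] §4.2, App. B.3; [Kato2004Asterisque] §17.13.
-/

set_option autoImplicit false
set_option linter.dupNamespace false -- D-0017: single-problem summit, the namespace repeats the problem name by design
noncomputable section

open scoped Classical
open CategoryTheory Function NumberField IsDedekindDomain Field

namespace Summit.BirchSwinnertonDyer.BirchSwinnertonDyer.Theorems.SmallImageRttD2Seq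

open Literature.NumberTheory.GaloisRepresentations Literature.NumberTheory.GaloisCohomology Literature.NumberTheory.EllipticCurves
  Literature.NumberTheory.ComplexMultiplication.EllipticUnits Literature.NumberTheory.ComplexMultiplication.EllipticUnits.JohnsonLeungKings2011
  Literature.NumberTheory.GaloisRepresentations.DiscreteGaloisModule Literature.NumberTheory.GaloisCohomology.PoitouTateFinite
  Summit.BirchSwinnertonDyer.BirchSwinnertonDyer.Theorems.SmallImageRttD2J1

/-! ## §1. The transpose on Tate duals -/

section Transpose

variable {K : Type} [Field K] [NumberField K] {M₁ M₂ : Type} [AddCommGroup M₁] [TopologicalSpace M₁] [DiscreteTopology M₁] [Finite M₁]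
  [AddCommGroup M₂] [TopologicalSpace M₂] [DiscreteTopology M₂] [Finite M₂]
  (ρ₁ : DiscreteGaloisModule K M₁) (ρ₂ : DiscreteGaloisModule K M₂) (N : ℕ)

/-- **The transpose `αᴰ : M₁^D → M₂^D`, `F ↦ F ∘ α`, of a `Γ_K`-morphism `α : M₂ → M₁`**, as a morphism of the topological representations underlying the Tate duals
(`(σF) ∘ α = σ(F ∘ α)` because `α` commutes with `σ⁻¹`). [cite: MilneADT2006, Ch. I §0, Cor. 2.3] -/
def tateDualTranspose (α : ρ₂.toTopRep ⟶ ρ₁.toTopRep) : (ρ₁.tateDual N).toTopRep ⟶ (ρ₂.tateDual N).toTopRep :=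
  TopRep.ofHom
    { toContinuousLinearMap :=
        { toLinearMap := (AddMonoidHom.compHom' (α.hom.toLinearMap.toAddMonoidHom) :
              (M₁ →+ MuCarrier K N) →+ (M₂ →+ MuCarrier K N)).toIntLinearMap
          cont := continuous_of_discreteTopology }
      isIntertwining' := fun σ => by
        ext F : 1
        refine TateDual.ext fun m => ?_
        change mu K N σ (F (ρ₁ σ⁻¹ (α.hom m))) = mu K N σ (F (α.hom (ρ₂ σ⁻¹ m)))
        rw [ContinuousRep.hom_comm_apply α σ⁻¹ m] }

omit [NumberField K] in
/-- Values of the transpose: `(αᴰ F) m = F (α m)`. [folklore] -/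
@[simp] theorem tateDualTranspose_hom_apply (α : ρ₂.toTopRep ⟶ ρ₁.toTopRep) (F : TateDual K M₁ N) (m : M₂) :
    ((tateDualTranspose ρ₁ ρ₂ N α).hom F : TateDual K M₂ N) m = F (α.hom m) :=
  rfl

end Transpose

/-! ## §2. The generic transpose law of `semilocPairNK` -/

section Generic

variable {K : Type} [Field K] [NumberField K] {p : ℕ} [Fact p.Prime] (S : Set (PadicAlgCl p)) [FiniteDimensional ℚ_[p] (padicCoeffField S)] (κ : ZpExtension K p)
  (θ' : absoluteGaloisGroup K →ₜ* (padicCoeffIntegers S)ˣ) (P : Set (HeightOneSpectrum (𝓞 K)))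
  (M : Type) [AddCommGroup M] [TopologicalSpace M] [DiscreteTopology M] [DistribMulAction (absoluteGaloisGroup K) M]
  (hstabK : ∀ m : M, IsOpen (MulAction.stabilizer (absoluteGaloisGroup K) m : Set (absoluteGaloisGroup K)))
  (PG : ∀ k : ℕ, ContPairing (coeffRepK S θ' P k).toTopRep (torsRep M hstabK p k).toTopRep (mu K (p ^ k)).toTopRep)
  (w : HeightOneSpectrum (𝓞 K))

/-- **The semilocal DUAL coefficients at `w` of level `(n, k)`**: the Tate dual `Maps(Γ_K ⧸ U_n, X_k)^D` restricted along `res_w` (honda's `TopRep.res` dialect).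
[cite: MilneADT2006, Ch. I, Cor. 2.3] [cite: NeukirchSchmidtWingberg2008, (7.2.6)] -/
abbrev semilocDualRep (n k : ℕ) : TopRep ℤ (absoluteGaloisGroup (w.adicCompletion K)) :=
  letI := layerQuotFintype κ n
  haveI := finite_oMuCarrier (K := K) S k
  TopRep.res (resGalOfEmb (closureEmb (K := K) (w.adicCompletion K)) : absoluteGaloisGroup (w.adicCompletion K) →* absoluteGaloisGroup K)
    ((DiscreteGaloisModule.coind (coeffRepK S θ' P k) (κ.layerSubgroup n) (κ.isOpen_layerSubgroup n)).tateDual (p ^ k)).toTopRep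

/-- **`res_w` on the dual side**, `H¹(Γ_K, Maps(Γ_K ⧸ U_n, X_k)^D) →+ H¹(Γ_{K_w}, Maps(Γ_K ⧸ U_n, X_k)^D)` (honda's dialect; definitionally the tree's `galoisCohomology.localization … (Sum.inr w) 1`).
[cite: NeukirchSchmidtWingberg2008, (8.6.2)] -/
def semilocDualRes (n k : ℕ) :
    letI := layerQuotFintype κ n
    haveI := finite_oMuCarrier (K := K) S k
    (continuousCohomology 1 ((DiscreteGaloisModule.coind (coeffRepK S θ' P k) (κ.layerSubgroup n) (κ.isOpen_layerSubgroup n)).tateDual (p ^ k)).toTopRep : Type) →+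
      continuousCohomology 1 (semilocDualRep S κ θ' P w n k) :=
  letI := layerQuotFintype κ n
  haveI := finite_oMuCarrier (K := K) S k
  (ContinuousCohomology.map (resGalOfEmb (closureEmb (K := K) (w.adicCompletion K))) (𝟙 (semilocDualRep S κ θ' P w n k)) 1).hom.toLinearMap.toAddMonoidHom

/-- Unfolding `semilocDualRes`. [folklore] -/
theorem semilocDualRes_apply (n k : ℕ)
    (z : letI := layerQuotFintype κ n
      haveI := finite_oMuCarrier (K := K) S k
      (continuousCohomology 1 ((DiscreteGaloisModule.coind (coeffRepK S θ' P k) (κ.layerSubgroup n) (κ.isOpen_layerSubgroup n)).tateDual (p ^ k)).toTopRep : Type)) :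
    semilocDualRes S κ θ' P w n k z =
      (ContinuousCohomology.map (resGalOfEmb (closureEmb (K := K) (w.adicCompletion K))) (𝟙 (semilocDualRep S κ θ' P w n k)) 1).hom z :=
  rfl

/-- **The evaluation pairing `Maps(Γ_K ⧸ U_n, X_k) × Maps(Γ_K ⧸ U_n, X_k)^D → μ_{p^k}` over `Γ_{K_w}`** in honda's `TopRep.res` dialect (definitionally the tree's
`tateDualPairingLocal … (Sum.inr w)`). [cite: MilneADT2006, Ch. I, Cor. 2.3] -/
def semilocEvalPairing (n k : ℕ) :
    ContPairing (semilocRep S κ θ' P w n k) (semilocDualRep S κ θ' P w n k)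
      (TopRep.res (resGalOfEmb (closureEmb (K := K) (w.adicCompletion K)) : absoluteGaloisGroup (w.adicCompletion K) →* absoluteGaloisGroup K) (mu K (p ^ k)).toTopRep) :=
  letI := layerQuotFintype κ n
  haveI := finite_oMuCarrier (K := K) S k
  tateDualPairingLocal (DiscreteGaloisModule.coind (coeffRepK S θ' P k) (κ.layerSubgroup n) (κ.isOpen_layerSubgroup n)) (p ^ k) (Sum.inr w)

-- As in N1: the base-field Poitou–Tate package speaks `((coind X U).toLocal (Sum.inr w)).toTopRep` / `localization` / `tateDualPairingLocal`, honda's tower speaks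
-- `TopRep.res res_w (coindFin X.toTopRep U)` / `ContinuousCohomology.map res_w` (T1-a): two DEFINITIONALLY equal dialects; the identification by `rfl` is expensive but is paid ONCE
-- here — the laws below rewrite with this lemma and stay in honda's dialect.
set_option maxHeartbeats 2000000 in
/-- ★ **`semilocPairNK` read in honda's dialect**: `⟨t, semilocDual c⟩_{w,n} = inv_w^{can}( t ∪_{ev} res_w(H¹(Ψ_{n,k})(Sh_{U_n} c)) )` (definitional). [cite: MilneADT2006, Ch. I, Cor. 2.3] -/
theorem semilocPairNK_eq_canonical_cupProduct (n k : ℕ) (t : semilocCoh S κ θ' P w n k 1)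
    (c : continuousCohomology 1 (subgroupRep (torsRep M hstabK p k).toTopRep (κ.layerSubgroup n))) :
    letI := layerQuotFintype κ n
    haveI := finite_oMuCarrier (K := K) S k
    haveI : NeZero (p ^ k) := ⟨pow_ne_zero _ (Fact.out : p.Prime).ne_zero⟩
    haveI : CompactSpace (absoluteGaloisGroup (w.adicCompletion K)) := absoluteGaloisGroup_compactSpace _
    semilocPairNK S κ θ' P M hstabK PG w n k t c =
      LocalInvariants.canonical K (p ^ k) (Sum.inr w) ((semilocEvalPairing S κ θ' P w n k).cupProduct t
        (semilocDualRes S κ θ' P w n k (cohomologyMap (coindTateDualMor (coeffRepK S θ' P k) (torsRep M hstabK p k) (κ.layerSubgroup n)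
          (pairingB S θ' P M hstabK PG k) (κ.isOpen_layerSubgroup n) (pairingB_smul S θ' P M hstabK PG k)) 1
          (shapiroLift (torsRep M hstabK p k).toTopRep (κ.layerSubgroup n) (κ.isOpen_layerSubgroup n) (layerReps_spec κ n) (layerReps_one κ n) c)))) :=
  rfl

set_option maxHeartbeats 2000000 in
/-- ★★ **THE GENERIC TRANSPOSE LAW.** Let `α : Maps(Γ_K ⧸ U_{n′}, X_k) ⟶ Maps(Γ_K ⧸ U_n, X_k)` and `β : Maps(Γ_K ⧸ U_n, M[p^k]) ⟶ Maps(Γ_K ⧸ U_{n′}, M[p^k])` be `Γ_K`-morphisms, ADJOINT for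
the summed level pairings — `Σ_y B((α φ) y, ψ y) = Σ_{y′} B(φ y′, (β ψ) y′)` — and let `c ∈ H¹(U_n, M[p^k])`, `c′ ∈ H¹(U_{n′}, M[p^k])` satisfy `Sh_{U_{n′}} c′ = H¹(β)(Sh_{U_n} c)`. Then for every
semilocal class `t ∈ Lloc_w(n′,k)`: `⟨H¹(α|_w) t, semilocDual c⟩_{w,n} = ⟨t, semilocDual c′⟩_{w,n′}` (canonical local Tate pairings of the coinduced modules at `w`). Proof: `αᴰ ∘ Ψ_n = Ψ_{n′} ∘ β`
pointwise; the cup product at `Γ_{K_w}` is adjoint-natural for `(α|_w, αᴰ|_w)` under the evaluation pairings; `res_w` is natural. [cite: NeukirchSchmidtWingberg2008, I §4 (1.4.2), (7.2.6), (8.6.2)]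
[cite: MilneADT2006, Ch. I, Cor. 2.3] -/
theorem semilocPairNK_semilocH_eq {n n' : ℕ} (k : ℕ)
    (α : coindFin.{0, 0} (coeffRepK S θ' P k).toTopRep (κ.layerSubgroup n') ⟶ coindFin.{0, 0} (coeffRepK S θ' P k).toTopRep (κ.layerSubgroup n))
    (β : coindFin.{0, 0} (torsRep M hstabK p k).toTopRep (κ.layerSubgroup n) ⟶ coindFin.{0, 0} (torsRep M hstabK p k).toTopRep (κ.layerSubgroup n'))
    (hαβ : letI := layerQuotFintype κ n
      letI := layerQuotFintype κ n'
      ∀ (φ : coindFin.{0, 0} (coeffRepK S θ' P k).toTopRep (κ.layerSubgroup n')) (ψ : coindFin.{0, 0} (torsRep M hstabK p k).toTopRep (κ.layerSubgroup n)),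
        ∑ y : absoluteGaloisGroup K ⧸ κ.layerSubgroup n, pairingB S θ' P M hstabK PG k (α.hom φ y) (ψ y) =
          ∑ y' : absoluteGaloisGroup K ⧸ κ.layerSubgroup n', pairingB S θ' P M hstabK PG k (φ y') (β.hom ψ y'))
    (t : semilocCoh S κ θ' P w n' k 1)
    (c : continuousCohomology 1 (subgroupRep (torsRep M hstabK p k).toTopRep (κ.layerSubgroup n)))
    (c' : continuousCohomology 1 (subgroupRep (torsRep M hstabK p k).toTopRep (κ.layerSubgroup n')))
    (hSh : shapiroLift (torsRep M hstabK p k).toTopRep (κ.layerSubgroup n') (κ.isOpen_layerSubgroup n') (layerReps_spec κ n') (layerReps_one κ n') c' =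
      cohomologyMap β 1 (shapiroLift (torsRep M hstabK p k).toTopRep (κ.layerSubgroup n) (κ.isOpen_layerSubgroup n) (layerReps_spec κ n) (layerReps_one κ n) c)) :
    semilocPairNK S κ θ' P M hstabK PG w n k (semilocH S κ θ' P w α 1 t) c = semilocPairNK S κ θ' P M hstabK PG w n' k t c' := by
  letI := layerQuotFintype κ n
  letI := layerQuotFintype κ n'
  haveI := finite_oMuCarrier (K := K) S k
  haveI : NeZero (p ^ k) := ⟨pow_ne_zero _ (Fact.out : p.Prime).ne_zero⟩
  haveI : CompactSpace (absoluteGaloisGroup (w.adicCompletion K)) := absoluteGaloisGroup_compactSpace _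
  -- the two coinduced X-modules, their duality morphisms `Ψ`, and the transpose of `α`
  set ρ : DiscreteGaloisModule K (absoluteGaloisGroup K ⧸ κ.layerSubgroup n → ↥(Representation.invariants ((muTwistO S θ' k).toRepresentation.comp (ramificationSubgroup K P).subtype))) :=
    DiscreteGaloisModule.coind (coeffRepK S θ' P k) (κ.layerSubgroup n) (κ.isOpen_layerSubgroup n) with hρ
  set ρ' : DiscreteGaloisModule K (absoluteGaloisGroup K ⧸ κ.layerSubgroup n' → ↥(Representation.invariants ((muTwistO S θ' k).toRepresentation.comp (ramificationSubgroup K P).subtype))) :=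
    DiscreteGaloisModule.coind (coeffRepK S θ' P k) (κ.layerSubgroup n') (κ.isOpen_layerSubgroup n') with hρ'
  set Ψ := coindTateDualMor (coeffRepK S θ' P k) (torsRep M hstabK p k) (κ.layerSubgroup n) (pairingB S θ' P M hstabK PG k)
    (κ.isOpen_layerSubgroup n) (pairingB_smul S θ' P M hstabK PG k) with hΨ
  set Ψ' := coindTateDualMor (coeffRepK S θ' P k) (torsRep M hstabK p k) (κ.layerSubgroup n') (pairingB S θ' P M hstabK PG k)
    (κ.isOpen_layerSubgroup n') (pairingB_smul S θ' P M hstabK PG k) with hΨ'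
  set αD : (ρ.tateDual (p ^ k)).toTopRep ⟶ (ρ'.tateDual (p ^ k)).toTopRep := tateDualTranspose ρ ρ' (p ^ k) α with hαD
  -- (1) the global module identity `αᴰ ∘ Ψ_n = Ψ_{n′} ∘ β`, on classes
  have hmod : ∀ ψ : coindFin.{0, 0} (torsRep M hstabK p k).toTopRep (κ.layerSubgroup n), αD.hom (Ψ.hom ψ) = Ψ'.hom (β.hom ψ) := fun ψ ↦ by
    refine TateDual.ext fun φ ↦ ?_
    rw [hαD, tateDualTranspose_hom_apply, hΨ, hΨ', coindTateDualMor_hom_apply, coindTateDualMor_hom_apply, coindTateDualHom_apply_apply,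
      coindTateDualHom_apply_apply]
    exact hαβ φ ψ
  have hglob : ∀ z : continuousCohomology 1 (coindFin.{0, 0} (torsRep M hstabK p k).toTopRep (κ.layerSubgroup n)),
      cohomologyMap αD 1 (cohomologyMap Ψ 1 z) = cohomologyMap Ψ' 1 (cohomologyMap β 1 z) := fun z ↦ by
    have e1 := map_comp_apply_of (ContinuousMonoidHom.id (absoluteGaloisGroup K)) (ContinuousMonoidHom.id (absoluteGaloisGroup K))
      (ContinuousMonoidHom.id (absoluteGaloisGroup K)) (fun _ ↦ rfl) (resIdHom Ψ) (resIdHom αD) (resIdHom (β ≫ Ψ')) (fun v ↦ (hmod v).symm) 1 z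
    have e2 := map_comp_apply_of (ContinuousMonoidHom.id (absoluteGaloisGroup K)) (ContinuousMonoidHom.id (absoluteGaloisGroup K))
      (ContinuousMonoidHom.id (absoluteGaloisGroup K)) (fun _ ↦ rfl) (resIdHom β) (resIdHom Ψ') (resIdHom (β ≫ Ψ')) (fun _ ↦ rfl) 1 z
    exact e1.symm.trans e2
  -- (2) naturality of `res_w` on the dual side (honda's dialect)
  have hloc : ∀ z : continuousCohomology 1 (ρ.tateDual (p ^ k)).toTopRep,
      semilocDualRes S κ θ' P w n' k (cohomologyMap αD 1 z) =
        cohomologyMap ((TopRep.resFunctor (resGalOfEmb (closureEmb (K := K) (w.adicCompletion K)) :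
          absoluteGaloisGroup (w.adicCompletion K) →* absoluteGaloisGroup K)).map αD) 1 (semilocDualRes S κ θ' P w n k z) := fun z ↦ by
    rw [semilocDualRes_apply, semilocDualRes_apply, map_cohomologyMap_eq_map, Category.comp_id, cohomologyMap_map_id_eq_map]
  -- (3) adjoint naturality of the cup product at `Γ_{K_w}` for `(α|_w, αᴰ|_w)` under the evaluation pairings (honda's dialect)
  have hcup : ∀ (a : semilocCoh S κ θ' P w n' k 1) (b : continuousCohomology 1 (semilocDualRep S κ θ' P w n k)),
      (semilocEvalPairing S κ θ' P w n k).cupProduct (semilocH S κ θ' P w α 1 a) b =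
        (semilocEvalPairing S κ θ' P w n' k).cupProduct a
          (cohomologyMap ((TopRep.resFunctor (resGalOfEmb (closureEmb (K := K) (w.adicCompletion K)) :
            absoluteGaloisGroup (w.adicCompletion K) →* absoluteGaloisGroup K)).map αD) 1 b) := fun a b ↦ by
    rw [semilocH_apply]
    exact ContPairing.cupProduct_adjoint (semilocEvalPairing S κ θ' P w n' k) (semilocEvalPairing S κ θ' P w n k)
      ((TopRep.resFunctor (resGalOfEmb (closureEmb (K := K) (w.adicCompletion K)) : absoluteGaloisGroup (w.adicCompletion K) →* absoluteGaloisGroup K)).map α)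
      ((TopRep.resFunctor (resGalOfEmb (closureEmb (K := K) (w.adicCompletion K)) : absoluteGaloisGroup (w.adicCompletion K) →* absoluteGaloisGroup K)).map αD)
      (fun _ _ ↦ rfl) a b
  -- assemble
  rw [semilocPairNK_eq_canonical_cupProduct, semilocPairNK_eq_canonical_cupProduct, hSh, ← hglob, hloc]
  exact congrArg (LocalInvariants.canonical K (p ^ k) (Sum.inr w)) (hcup t _)

end Generic

/-! ## §3. The laws: cores ⊣ res and conj ⊣ conj⁻¹ -/

section Laws

variable {K : Type} [Field K] [NumberField K] {p : ℕ} [Fact p.Prime] (S : Set (PadicAlgCl p)) [FiniteDimensional ℚ_[p] (padicCoeffField S)] (κ : ZpExtension K p)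
  (θ' : absoluteGaloisGroup K →ₜ* (padicCoeffIntegers S)ˣ) (P : Set (HeightOneSpectrum (𝓞 K)))
  (M : Type) [AddCommGroup M] [TopologicalSpace M] [DiscreteTopology M] [DistribMulAction (absoluteGaloisGroup K) M]
  (hstabK : ∀ m : M, IsOpen (MulAction.stabilizer (absoluteGaloisGroup K) m : Set (absoluteGaloisGroup K)))
  (PG : ∀ k : ℕ, ContPairing (coeffRepK S θ' P k).toTopRep (torsRep M hstabK p k).toTopRep (mu K (p ^ k)).toTopRep)
  (w : HeightOneSpectrum (𝓞 K))

omit [NumberField K] [FiniteDimensional ℚ_[p] (padicCoeffField S)] in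
/-- The summed level pairing of honda's `PG k` IS the sum of `pairingB`'s (`coindFin_toLin_apply` for the tree pairing `pairing X_k M[p^k] μ B hB`). [folklore] -/
theorem coindFin_pairing_toLin_eq_sum (n k : ℕ) [Fintype (absoluteGaloisGroup K ⧸ κ.layerSubgroup n)]
    (φ : coindFin.{0, 0} (coeffRepK S θ' P k).toTopRep (κ.layerSubgroup n)) (ψ : coindFin.{0, 0} (torsRep M hstabK p k).toTopRep (κ.layerSubgroup n)) :
    ((pairing (coeffRepK S θ' P k) (torsRep M hstabK p k) (mu K (p ^ k)) (pairingB S θ' P M hstabK PG k) (pairingB_smul S θ' P M hstabK PG k)).coindFin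
        (κ.layerSubgroup n)).toLin φ ψ =
      ∑ y : absoluteGaloisGroup K ⧸ κ.layerSubgroup n, pairingB S θ' P M hstabK PG k (φ y) (ψ y) := by
  rw [ContPairing.coindFin_toLin_apply]
  rfl

set_option maxHeartbeats 2000000 in
/-- ★★ **L1 — cores ⊣ res.** `⟨semilocCores t, semilocDual c⟩_{w,n} = ⟨t, semilocDual (res_{U_{n+1}} c)⟩_{w,n+1}` for `t ∈ Lloc_w(n+1,k)`, `c ∈ H¹(U_n, M[p^k])`: the fibre sum `Σ` on the
X-side is adjoint to the pull-back `∘π` on the A-side under the summed pairings (`toLin_coindFinSum_left`), and `Sh_{U_{n+1}}(res c) = H¹(∘π)(Sh_{U_n} c)`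
(`cohomologyMap_coindFinRes_shapiroCocycle`, any representatives). [cite: NeukirchSchmidtWingberg2008, I §5 Prop. (1.5.3)(iv), I §6 (1.6.4)–(1.6.5)] [cite: Rubin2000, §4.2] -/
theorem semilocPairNK_semilocCores (n k : ℕ) (t : semilocCoh S κ θ' P w (n + 1) k 1)
    (c : continuousCohomology 1 (subgroupRep (torsRep M hstabK p k).toTopRep (κ.layerSubgroup n))) :
    semilocPairNK S κ θ' P M hstabK PG w n k (semilocCores S κ θ' P w n k 1 t) c =
      semilocPairNK S κ θ' P M hstabK PG w (n + 1) k t (resLe (torsRep M hstabK p k).toTopRep (κ.layerSubgroup_antitone (Nat.le_succ n)) 1 c) := by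
  letI := layerQuotFintype κ n
  letI := layerQuotFintype κ (n + 1)
  refine semilocPairNK_semilocH_eq S κ θ' P M hstabK PG w k (coindFinSum (coeffRepK S θ' P k).toTopRep (κ.layerSubgroup_antitone (Nat.le_succ n)))
    (coindFinRes (torsRep M hstabK p k).toTopRep (κ.layerSubgroup_antitone (Nat.le_succ n))) (fun φ ψ ↦ ?_) t c _ ?_
  · rw [← coindFin_pairing_toLin_eq_sum S κ θ' P M hstabK PG, ← coindFin_pairing_toLin_eq_sum S κ θ' P M hstabK PG]
    exact ContPairing.toLin_coindFinSum_left _ (κ.layerSubgroup_antitone (Nat.le_succ n)) φ ψ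
  · obtain ⟨f, rfl⟩ := oneCocycleClass_surjective _ c
    rw [resLe_oneCocycleClass, shapiroLift_oneCocycleClass, shapiroLift_oneCocycleClass,
      cohomologyMap_coindFinRes_shapiroCocycle (torsRep M hstabK p k).toTopRep (κ.layerSubgroup_antitone (Nat.le_succ n)) (κ.isOpen_layerSubgroup n)
        (κ.isOpen_layerSubgroup (n + 1)) (layerReps_spec κ n) (layerReps_one κ n) (layerReps_spec κ (n + 1)) (layerReps_one κ (n + 1)) f]

set_option maxHeartbeats 2000000 in
/-- ★★ **L3 — `R_γ ⊣ conj_{γ⁻¹}`.** `⟨semilocConj γ t, semilocDual c⟩_{w,n} = ⟨t, semilocDual (conj_{γ⁻¹} c)⟩_{w,n}`: right translation by `γU_n` on the X-side is adjoint to right translation by `γ⁻¹U_n`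
on the A-side under the summed pairing (`toLin_rTransHom`, reindexing), and `Sh(conj_{γ⁻¹} c) = H¹(R_{γ⁻¹})(Sh c)` (`shapiroLift_conjMap`). This is the law through which `T ↦ conj_γ − 1` on
`𝐇¹_{Iw,w}` becomes `conj_{γ⁻¹} − 1` on the Selmer side. [cite: SerreLocalFields1979, VII §5] [cite: NeukirchSchmidtWingberg2008, I §5 Prop. (1.5.3)(iv), (7.2.6)] [cite: Rubin2000, §4.2] -/
theorem semilocPairNK_semilocConj (n k : ℕ) (γ : absoluteGaloisGroup K) (t : semilocCoh S κ θ' P w n k 1)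
    (c : continuousCohomology 1 (subgroupRep (torsRep M hstabK p k).toTopRep (κ.layerSubgroup n))) :
    semilocPairNK S κ θ' P M hstabK PG w n k (semilocConj S κ θ' P w n k 1 γ t) c =
      semilocPairNK S κ θ' P M hstabK PG w n k t (conjMap (torsRep M hstabK p k).toTopRep (κ.layerSubgroup n) γ⁻¹ 1 c) := by
  letI := layerQuotFintype κ n
  refine semilocPairNK_semilocH_eq S κ θ' P M hstabK PG w k (rTransHom (coeffRepK S θ' P k).toTopRep (κ.layerSubgroup n) (γ : absoluteGaloisGroup K ⧸ κ.layerSubgroup n))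
    (rTransHom (torsRep M hstabK p k).toTopRep (κ.layerSubgroup n) ((γ⁻¹ : absoluteGaloisGroup K) : absoluteGaloisGroup K ⧸ κ.layerSubgroup n)) (fun φ ψ ↦ ?_) t c _ ?_
  · -- reindex `y ↦ y γ⁻¹`
    have h := ContPairing.toLin_rTransHom
      (pairing (coeffRepK S θ' P k) (torsRep M hstabK p k) (mu K (p ^ k)) (pairingB S θ' P M hstabK PG k) (pairingB_smul S θ' P M hstabK PG k))
      ((γ⁻¹ : absoluteGaloisGroup K) : absoluteGaloisGroup K ⧸ κ.layerSubgroup n)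
      ((rTransHom (coeffRepK S θ' P k).toTopRep (κ.layerSubgroup n) (γ : absoluteGaloisGroup K ⧸ κ.layerSubgroup n)).hom φ) ψ
    have hφ : (rTransHom (coeffRepK S θ' P k).toTopRep (κ.layerSubgroup n) ((γ⁻¹ : absoluteGaloisGroup K) : absoluteGaloisGroup K ⧸ κ.layerSubgroup n)).hom
        ((rTransHom (coeffRepK S θ' P k).toTopRep (κ.layerSubgroup n) (γ : absoluteGaloisGroup K ⧸ κ.layerSubgroup n)).hom φ) = φ := by
      funext y
      rw [rTransHom_apply, rTransHom_apply, mul_assoc, ← QuotientGroup.mk_mul, inv_mul_cancel, QuotientGroup.mk_one, mul_one]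
    rw [hφ] at h
    rw [← coindFin_pairing_toLin_eq_sum S κ θ' P M hstabK PG, ← coindFin_pairing_toLin_eq_sum S κ θ' P M hstabK PG]
    exact h.symm
  · rw [shapiroLift_conjMap]

/-! ### L4 — the `𝒪`-scalars -/

/-- **The scalar `a ∈ 𝒪` on `M[p^k]` as a `Γ_K`-morphism** of the topological representation `torsRep M hstabK p k` (the scalars commute with `Γ_K`). [cite: Rubin2000, §4.2] -/
def torsSMulHom [Module (padicCoeffIntegers S) M] [SMulCommClass (absoluteGaloisGroup K) (padicCoeffIntegers S) M] (a : padicCoeffIntegers S) (k : ℕ) :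
    (torsRep M hstabK p k).toTopRep ⟶ (torsRep M hstabK p k).toTopRep :=
  TopRep.ofHom
    { toContinuousLinearMap :=
        { toLinearMap := (DistribSMul.toAddMonoidHom (↥(torsionPow M p k)) a).toIntLinearMap
          cont := continuous_of_discreteTopology }
      isIntertwining' := fun σ => by
        ext m : 1
        refine Subtype.ext ?_
        change a • (σ • (m : M)) = σ • (a • (m : M))
        exact (smul_comm σ a (m : M)).symm }

omit [NumberField K] [FiniteDimensional ℚ_[p] (padicCoeffField S)] in
/-- Values of `torsSMulHom`. [folklore] -/
@[simp] theorem torsSMulHom_hom_apply [Module (padicCoeffIntegers S) M] [SMulCommClass (absoluteGaloisGroup K) (padicCoeffIntegers S) M] (a : padicCoeffIntegers S) (k : ℕ)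
    (m : ↥(torsionPow M p k)) : (torsSMulHom S M hstabK a k).hom m = a • m :=
  rfl

set_option maxHeartbeats 2000000 in
/-- ★★ **L4 — `H¹(a ⊗ id) ⊣ a`.** `⟨semilocScalar a t, semilocDual c⟩_{w,n} = ⟨t, semilocDual (H¹(a) c)⟩_{w,n}` for the `𝒪`-scalars, GIVEN the balance `P_k(a x, m) = P_k(x, a m)` of honda's level pairing
(hypothesis `hPsc`, as in g22's socket inhabitant `layerPairingOf`): `α = Maps(a ⊗ id)`, `β = Maps(a)`, and `Sh(H¹(a|_{U_n}) c) = H¹(Maps(a))(Sh c)` (`shapiroLift_cohomologyMap`). This is the law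
through which the constants `C a ∈ Λ_𝒪` act compatibly on both sides. [cite: Rubin2000, §4.2] [cite: NeukirchSchmidtWingberg2008, I §5 Prop. (1.5.3)(iv)] -/
theorem semilocPairNK_semilocScalar [Module (padicCoeffIntegers S) M] [SMulCommClass (absoluteGaloisGroup K) (padicCoeffIntegers S) M]
    (hPsc : ∀ (k : ℕ) (a : padicCoeffIntegers S) (x : ↥(Representation.invariants ((muTwistO S θ' k).toRepresentation.comp (ramificationSubgroup K P).subtype)))
      (m : ↥(torsionPow M p k)), (PG k).toLin (coeffMapO S P θ' (oMuScalar S (p ^ k) a) (oMuScalar_muTwistO S θ' k a) x) m = (PG k).toLin x (a • m))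
    (n k : ℕ) (a : padicCoeffIntegers S) (t : semilocCoh S κ θ' P w n k 1)
    (c : continuousCohomology 1 (subgroupRep (torsRep M hstabK p k).toTopRep (κ.layerSubgroup n))) :
    semilocPairNK S κ θ' P M hstabK PG w n k (semilocScalar S κ θ' P w n k 1 a t) c =
      semilocPairNK S κ θ' P M hstabK PG w n k t (cohomologyMap (subgroupRepMap (torsSMulHom S M hstabK a k) (κ.layerSubgroup n)) 1 c) := by
  letI := layerQuotFintype κ n
  refine semilocPairNK_semilocH_eq S κ θ' P M hstabK PG w k (coindFinMap (coeffHomK S θ' P (oMuScalar S (p ^ k) a) (oMuScalar_muTwistO S θ' k a)) (κ.layerSubgroup n))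
    (coindFinMap (torsSMulHom S M hstabK a k) (κ.layerSubgroup n)) (fun φ ψ ↦ ?_) t c _ ?_
  · exact Finset.sum_congr rfl fun y _ ↦ by
      rw [coindFinMap_apply, coindFinMap_apply, pairingB_apply, pairingB_apply, torsSMulHom_hom_apply]
      exact hPsc k a (φ y) (ψ y)
  · rw [shapiroLift_cohomologyMap]

end Laws

end Summit.BirchSwinnertonDyer.BirchSwinnertonDyer.Theorems.SmallImageRttD2Seq

end
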